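import Summits.QuantumFields.YangMills.Theorems.BalabanUVNodesN20GappedRoadCutZeroKnit

/-!
# BalabanUVNodes ∕ N20 (NE7b) — THE CANDIDATE STUB-2 TEXT ON THE GAPPED ROAD AT THE ZERO CUT, KERNEL-CHECKED TO CLOSE K3⁸ WITH STUB 1 UNCHANGED: «for every `β ∈ ]2∕3, 1[` and
# every N16-guarded rate reading carrying the K4 rates, there are dials `(ρ, n)` with their rows such that the two runs' GAPPED cores match on EVERY keyed class with a summable
# rate (slot-keyed, under the crux's prefix) and node U5's Target holds off the live line» — NO `KeyedRelWeight`, NO `KeyedShellWeight`, NO `KeyedExtractionV`, NO pin in the text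
# (the three faces are theorems on this road: p630052 ∕ p626047 ∕ p622874; the reading is minted in the proof); the (H-ζ) row stays displayed

Cell `pub-ymgap` (HUMAN RULING D-0062 Track A; width push D-0149, director-ym №197), width seat `pub-ymgap-dag-n20-w2` (gen 5) on node N20 = NE7b; key item K3⁸
`SpineGivenEndpointR13SepCoPHV` = stmt-QuantumFields-27366 (KEY MAP v2); `--kind proof --supports … --as helper`; COUNT-NEUTRAL; LOCATED; CONDITIONAL (`proof.conditional`, credits
nothing).  NOT a skeleton, NOT a registration, NOT `stub_expansion13HV` (the registered v6 pins `crOfRecord₁₃V`; a gapped pin ∕ text is the PLANNER's call — this file is the kernel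
form of that alternative, for the plan's reading).  [LF-I] = [Balaban1989LargeFieldI], [LF-II] = [Balaban1989LargeFieldII].

WHY.  dag-n27-w1's tree mirror `K3V6Defs.spineGivenEndpointR13SepCoPHV_of_stubTextsV` composes K3⁸ from the two REGISTERED v6 stub texts (stub 1: `∃ β ∈ ]2∕3,1[, ∃ 𝔯 ksel ℓ ℓ₃ g B,
GuardedReadingN16 … ∧ KeyedRatesHolderD4V β (rrOfRecord 𝔯 ksel)`; stub 2: `… → ∃ jc sh cr, PinnedAtLive jc sh cr ∧` four faces).  On dag-n21-d's gapped road at the zero cut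
(`…N20GappedRoadCutZeroKnit.spineGivenEndpointR13SepCoPHV_of_gapRoad_cutZero`, this seat) three of the four faces are theorems and the pin is minted, so the SECOND text can shrink to
its content.  This file states that shrunken text — `GapCoreCutZeroText` below, spelled INLINE as a hypothesis (no `def`) — and proves: stub 1's registered text + the shrunken text +
the (H-ζ) row ⇒ K3⁸ (`spineGivenEndpointR13SepCoPHV_of_stubRates_of_gapCoreCutZero`).  The (H-ζ) row («`θ.ζ` jointly measurable at the guarded admissible tuples of the live line»)
is a statement about the residual ζ of ARBITRARY tuples, hence NOT provable as a ∀-θ text — it belongs in a proviso ∕ guard edition (plan ∕ NODE 00), and is displayed here as the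
separate binder `hζm` exactly as in n21-d's knit.
* ★★★ `spineGivenEndpointR13SepCoPHV_of_stubRates_of_gapCoreCutZero` — K3⁸ from: (h₁) stub 1's v6 text VERBATIM; (hζm) the (H-ζ) row; (h₂) «∀ β ∈ ]2∕3,1[, ∀ 𝔯 ksel ℓ ℓ₃ g B,
  GuardedReadingN16 → KeyedRatesHolderD4V β (rrOfRecord 𝔯 ksel) → ∃ (ρ : WidthLetter₁₃CoPH 2) (n : DepthLetter₁₃CoPH 2), rows(ρ, n) ∧ N19′-all-classes at the gapped cores (slot-keyed,
  prefixed, `PHolderD4 β`) ∧ node U5's Target off the live line»;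
WHAT IT SAYS (located, count-neutral): were the plan to pin the gapped road at the zero cut, stub 2 of K3 would read «dials + NE7 proper between the two runs' gapped cores on every
keyed class + Target off the live line» and the composition is THIS theorem (+ the (H-ζ) proviso); N20 ∕ N21 ∕ N27x disappear from the text.  Nothing is registered or proposed here.
Cited BY NAME, not re-typed: `K3V5Defs ∕ K3V6Defs` (dag-n27-w1: `GuardedReadingN16`, `rrOfRecord`, `RunSel`, `LetterReading`, `KeyedRatesHolderD4V`, `PHolderD4`, `LiveSel`),
`…N20GappedRoadCutZeroKnit` (this seat), n21-d's gapped objects `gapCoreA∕B₁₃`, `WidthLetter₁₃CoPH ∕ DepthLetter₁₃CoPH`.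

HONEST FRAMING.  Pure logic over named texts; NO estimate of Bałaban's asserted or used; both texts and the (H-ζ) row are HYPOTHESES inhabited for no family (K0⁷ OPEN); NE7 ∕ NE7b ∕
NE7c NOT PRINTED for `d = 4`, NOT proved; N19 ∕ N20 ∕ N21 ∕ N27 NOT discharged; K3⁸ NOT claimed ∕ NOT closed (v6 stands); counts unmoved (typed 28∕28 · discharged 5∕27); no count
claim.  One finite `𝕋⁴_{L^K}` programme at fixed `ε`, Bałaban AS PRINTED; the YM mass gap (Clay) is NOT proved by any of this — R4 closes the conditional finite-𝕋⁴ rung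
`BalabanLadder.UV` only; NOT ℝ⁴, NOT infinite volume, NOT OS.  No `def`, no `instance`, no `notation`, no `sorry`.
Sources (locators, bookkeeping only): [LF-I] p.181; [LF-II] Thm 1 + (0.1) pp.355–356, (1.80) p.384; [King1986] (3.10)–(3.11) p.656.
-/

set_option autoImplicit false

noncomputable section

open scoped BigOperators

namespace Summit.QuantumFields.YangMills.BalabanUVNodes.N20GappedRoadCutZeroStubShape

open Literature.MathematicalPhysics.QuantumFieldTheory.Balaban1983to89
open Literature.MathematicalPhysics.QuantumFieldTheory.Balaban1983to89.T4Continuum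
open Literature.MathematicalPhysics.QuantumFieldTheory.Balaban1983to89.Node00
open T4ContinuumYM4Torus (ForSmallCouplings)
open Summit.QuantumFields.BalabanUV.T4Continuum.Spine
open YMDAG.UVSplit (classSet₁₃ RateReading₁₃CoPH)
open Summit.QuantumFields.YangMills.Theorems.K3V5Defs (RunSel LetterReading rrOfRecord GuardedReadingN16 LiveSel PHolderD4)
open Summit.QuantumFields.YangMills.Theorems.K3V6Defs (KeyedRatesHolderD4V)
open Summit.QuantumFields.YangMills.Theorems.N21ShellSplitOfRecord13CoPH (WidthLetter₁₃CoPH DepthLetter₁₃CoPH gapCoreA₁₃ gapCoreB₁₃)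
open Summit.QuantumFields.YangMills.BalabanUVNodes.N20GappedRoadCutZeroKnit (spineGivenEndpointR13SepCoPHV_of_gapRoad_cutZero)

/-! ## Stub 1's registered text + the shrunken gapped-road text at the zero cut + the (H-ζ) row ⇒ K3⁸ -/

/-- ★★★ **K3⁸ FROM STUB 1's v6 TEXT, THE CANDIDATE GAPPED-ROAD STUB-2 TEXT AT THE ZERO CUT, AND THE (H-ζ) ROW.**  `h₁` = `stub_rates13HV`'s text VERBATIM (tree names); `h₂` = for every
`β ∈ ]2∕3,1[` and every N16-guarded rate reading with the K4 rates: dials `(ρ, n)` with `0 ≤ ρ ≤ 1`, `Σ_K 1∕(n_K+1) < ∞`, the NE7 core edge between the two runs' GAPPED cores on EVERY keyed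
class with a summable rate (every slot `v`, under (B) → END → `ForSmallCouplings` at the slot datum, `PHolderD4 β`), and node U5's Target at the datum off the live line; `hζm` = (H-ζ)
on the live line.  CONDITIONAL; nothing of Bałaban's proved; NOT a registration. [cite: Balaban1989LargeFieldII, Thm 1 + (0.1) pp.355–356, (1.80) p.384; Balaban1989LargeFieldI, p.181; King1986, (3.10)–(3.11) p.656 (bookkeeping)] -/
theorem spineGivenEndpointR13SepCoPHV_of_stubRates_of_gapCoreCutZero
    (h₁ : ∃ β : ℝ, 2 / 3 < β ∧ β < 1 ∧
      ∃ (𝔯 : RateReading₁₃CoPH 2) (ksel : RunSel) (ℓ : LetterReading) (ℓ₃ : T4Family → Node00.NE3Letters₁₁) (g B : T4Family → ℝ),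
        GuardedReadingN16 𝔯 ksel ℓ ℓ₃ g B ∧ KeyedRatesHolderD4V β (rrOfRecord 𝔯 ksel))
    (hζm : ∀ (F : T4Family) (θ : Stage13HParams F 2), θ.Provisos₁₃CoPH F 2 → ((θ.ZhUnity F 2 ∧ θ.SlotsNondegenerate₁₃ F 2) ∧ LiveSel F θ) → θ.Admissible F 2 →
      ZetaMeasurable F 2 θ.ζ)
    (h₂ : ∀ β : ℝ, 2 / 3 < β → β < 1 →
      ∀ (𝔯 : RateReading₁₃CoPH 2) (ksel : RunSel) (ℓ : LetterReading) (ℓ₃ : T4Family → Node00.NE3Letters₁₁) (g B : T4Family → ℝ),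
        GuardedReadingN16 𝔯 ksel ℓ ℓ₃ g B → KeyedRatesHolderD4V β (rrOfRecord 𝔯 ksel) →
        ∃ (ρ : WidthLetter₁₃CoPH 2) (n : DepthLetter₁₃CoPH 2),
          (∀ (F : T4Family) (θ : Stage13HParams F 2) (hP : θ.Provisos₁₃CoPH F 2) (g₀ : ℕ → ℝ) (os : List (ULoop F)) (K : ℕ),
            0 ≤ ρ F θ hP g₀ os K ∧ ρ F θ hP g₀ os K ≤ 1) ∧
          (∀ (F : T4Family) (θ : Stage13HParams F 2) (hP : θ.Provisos₁₃CoPH F 2) (g₀ : ℕ → ℝ) (os : List (ULoop F)),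
            Summable (fun K => 1 / ((n F θ hP g₀ os K : ℝ) + 1))) ∧
          (∀ (F : T4Family) (θ : Stage13HParams F 2) (h : θ.Provisos₁₃SepCoPH F 2) (v : Revision₁₃ F 2 θ h),
            ((θ.ZhUnity F 2 ∧ θ.SlotsNondegenerate₁₃ F 2) ∧ LiveSel F θ) → θ.Admissible F 2 →
            B16.EndStatementBPrinted (datumOfRecord₁₃SepCoPHV F 2 θ h v).C → DagBinding.EndpointExistence (datumOfRecord₁₃SepCoPHV F 2 θ h v).C.toB12 →
              ForSmallCouplings (datumOfRecord₁₃SepCoPHV F 2 θ h v) fun g₀ => ∀ os : List (ULoop F),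
                PHolderD4 β (datumOfRecord₁₃SepCoPHV F 2 θ h v) (rrOfRecord 𝔯 ksel F θ h.toCore g₀ os) →
                  ∃ δ : ℕ → ℝ, (∀ K : ℕ, ∃ c : ℝ, ∀ t : ℝ, |t| ≤ 1 → ∀ x ∈ classSet₁₃ θ 0 g₀ K,
                    Real.exp (c - F.side ^ 4 * δ K) * gapCoreA₁₃ θ h.toCore 0 g₀ os (ρ F θ h.toCore g₀ os) (n F θ h.toCore g₀ os) K t x ≤
                        gapCoreB₁₃ θ h.toCore 0 g₀ os (ρ F θ h.toCore g₀ os) (n F θ h.toCore g₀ os) K t x ∧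
                      gapCoreB₁₃ θ h.toCore 0 g₀ os (ρ F θ h.toCore g₀ os) (n F θ h.toCore g₀ os) K t x ≤
                        Real.exp (c + F.side ^ 4 * δ K) * gapCoreA₁₃ θ h.toCore 0 g₀ os (ρ F θ h.toCore g₀ os) (n F θ h.toCore g₀ os) K t x) ∧ Summable δ) ∧
          (∀ (F : T4Family) (θ : Stage13HParams F 2) (hP : θ.Provisos₁₃CoPH F 2), ((θ.ZhUnity F 2 ∧ θ.SlotsNondegenerate₁₃ F 2) ∧ ¬ LiveSel F θ) → θ.Admissible F 2 →
            ∀ (g₀ : ℕ → ℝ) (os : List (ULoop F)), PHolderD4 β (datumOfRecord₁₃CoPH F 2 θ hP) (rrOfRecord 𝔯 ksel F θ hP g₀ os) →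
              ∃ δ : ℕ → ℝ, NE7.Target ((F.side : ℝ) ^ 4) 1 δ (fun K => T4GenFunBounds.schemeZ ((datumOfRecord₁₃CoPH F 2 θ hP).scheme g₀) os (0 + K)))) :
    Summit.QuantumFields.YangMills.Theses.BalabanUVNodes.SpineGivenEndpointR13SepCoPHV := by
  obtain ⟨β, hβ, hβ', 𝔯, ksel, ℓ, ℓ₃, g, B, hg, hr⟩ := h₁
  obtain ⟨ρ, n, hρ, hn, h19, htarget⟩ := h₂ β hβ hβ' 𝔯 ksel ℓ ℓ₃ g B hg hr
  exact spineGivenEndpointR13SepCoPHV_of_gapRoad_cutZero β (rrOfRecord 𝔯 ksel) ρ n hζm hρ hn hr h19 htarget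

end Summit.QuantumFields.YangMills.BalabanUVNodes.N20GappedRoadCutZeroStubShape

end
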